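import Mathlib.LinearAlgebra.TensorProduct.Quotient
import Literature.NumberTheory.Automorphic.LocalSchwartzBruhatDirectSum
import HarnessLib

/-!
# A functional that kills the first-factor relations sees a first-factor quotient-scalar: `λ((T f₁) ⊠ f₂) = c · λ(f₁ ⊠ f₂)`

Topic `NumberTheory/Automorphic`; namespace `Literature.NumberTheory.Automorphic`.  KERNEL MATHEMATICS ONLY (theorems, no `def`,
no named fact, no `sorry`, no instance, no notation).  Cell `hodgecm-mathlib` (D-0151), programme P2, N3 ROAD NOTE v2
(`F0/P2/B-p18/g28/N3-ROAD.v2.B-p18g28.md` §2) brick **(D3c)** «pure algebra: a functional on `A ⊗ B` killing `(ρ(k)a − a) ⊗ b`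
factors through `(A ⧸ span{ρ(k)a − a}) ⊗ B`, so if an operator `T` acts on the quotient `A ⧸ … = S_Y` by the scalar `c` then
`λ′((T f₁) ⊠ f₂) = c · λ′(f₁ ⊠ f₂)`», and the uniqueness step of **(D3d)** «pick `f₁ ⊠ f₂` with `λ′(f₁ ⊠ f₂) ≠ 0` ⇒ the two
scalars agree».  Everything here is elementary multilinear algebra; the Weil-representation content of (D3) lives elsewhere.

GENERIC PARENT: the pure-tensor identity of §1 is ★ `F0P2oDoubledGraphLagrangian.functional_tmul_eq_smul_of_quotient_scalar` ∕
`functional_equiv_tmul_eq_smul_of_quotient_scalar` (B-p18 (g28), ED. 2 §5, Summits side); this Literature file restates that one-liner for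
self-containedness (Literature never imports Summits) and carries the `𝒮`-MODEL COROLLARIES over ★ `sumEndSB`∕`boxSB` — the operator form
`lam ∘ (B₁ ⊠ 1) = c • lam`, uniqueness of the scalar, existence of a product with `lam ≠ 0` — which is the shape the (D3d) assembler consumes.

* §1 GENERIC, over a commutative ring `k`: for a linear map `lam : A ⊗[k] B →ₗ[k] M`, a submodule `U ≤ A` («first-factor
  relations») with `lam (u ⊗ₜ b) = 0` for `u ∈ U`, and a linear `T : A →ₗ[k] A` acting on `A ⧸ U` by the scalar `c`
  (`T a − c • a ∈ U` for all `a`): `lam (T a ⊗ₜ b) = c • lam (a ⊗ₜ b)` (`apply_tmul_eq_smul_of_sub_smul_mem`), the whole-map form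
  `lam ∘ₗ (T ⊗ 1) = c • lam` (`comp_rTensor_eq_smul_of_sub_smul_mem`), its transport along a linear equivalence
  `e : A ⊗[k] B ≃ₗ[k] C` to any operator `T̂` of `C` with `T̂ (e (a ⊗ₜ b)) = e (T a ⊗ₜ b)` (`comp_eq_smul_of_apply_equiv_tmul`),
  the factorisation of `lam` through `(A ⧸ U) ⊗[k] B` (Mathlib `TensorProduct.quotientTensorEquiv`;
  `exists_factor_quotientTensor`), and — over a field — the UNIQUENESS of the scalar: an eigen-relation `lam ∘ₗ T̂ = c' • lam` with
  `lam ≠ 0` forces `c' = c` (`eq_of_comp_eq_smul_of_ne_zero`).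
* §2 THE SCHWARTZ–BRUHAT INSTANCE along a coordinate splitting `e : ι₁ ⊕ ι₂ ≃ ι` of a non-archimedean local field `K`
  (★ `sumEquivSB K e : 𝒮(K^{ι₁}) ⊗ 𝒮(K^{ι₂}) ≃ₗ 𝒮(K^ι)`, ★ `boxSB K e f₁ f₂ = f₁ ⊠ f₂`, ★ `sumEndSB K e B₁ B₂ = B₁ ⊠ B₂`): for a linear
  functional `lam` on `𝒮(K^ι)` vanishing on every `u ⊠ f₂`, `u ∈ U ≤ 𝒮(K^{ι₁})`, and `B₁` acting on `𝒮(K^{ι₁}) ⧸ U` by the scalar `c`: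
  `lam ((B₁ f₁) ⊠ f₂) = c * lam (f₁ ⊠ f₂)` (`apply_boxSB_eq_mul_of_sub_smul_mem`), `lam ∘ₗ (B₁ ⊠ 1) = c • lam`
  (`comp_sumEndSB_id_eq_smul_of_sub_smul_mem`), and the uniqueness `c' = c` from `lam ∘ₗ (B₁ ⊠ 1) = c' • lam`, `lam ≠ 0`
  (`eq_of_comp_sumEndSB_id_eq_smul`) — also read at a single product `f₁ ⊠ f₂` with `lam (f₁ ⊠ f₂) ≠ 0`
  (`eq_of_apply_boxSB_eq_mul_of_ne_zero`).

Use of record (N3 ROAD v2 §2 (D3d)): `lam = λ′ = ev₀ ∘ r(δ′) ∘ ω^𝔻(w₀)⁻¹` (the `Δ′ ⊗ W`-coinvariant functional of the doubled Weil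
representation on `𝒮(𝕎^𝔻) = 𝒮 ⊠ 𝒮⁻`), `U` = the `(Y ⊕ 0) ⊗ W`-relations of the first factor, `B₁ = ω(s_v m(α))` acting on `S_Y = 𝒮 ⧸ U` by
Schur's scalar `c(α)`, `m(α) ⊕ 1 ↦ B₁ ⊠ 1` by undoubling (★ `omegaLoc_inlLoc_boxSB`), `c' = μ_w(α)|α|_w^{1/2}` from the
`P_{Δ′}`-eigen-law (★ `eigenfunctional_conj` + ★ `localSplittingDatumCM_parabolic`) ⇒ `c(α) = μ_w(α)|α|_w^{1/2}` = print's (3.2.2).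
Nothing of that is asserted here.  HC_CM is proved only modulo the printed citations until rung 0 closes; this file is count-neutral.

## References
* [BourbakiAlgebraI1989] N. Bourbaki, *Algebra I*, Chap. II §3.6 Prop. 6 (right exactness of `⊗`: `(A/U) ⊗ B = (A ⊗ B)/(U ⊗ B)`).
* [WeilBNT1967] A. Weil, *Basic Number Theory*, Chap. VII §2, Prop. 2 (`𝒮(K^ι) = 𝒮(K^{ι₁}) ⊗ 𝒮(K^{ι₂})`).
* [MoeglinVignerasWaldspurger1987] LNM 1291, Chap. 2 II.1 Rem. (6) (product operators `B₁ ⊠ B₂`); Chap. 3 §IV.5 (Jacquet modules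
  of Weil representations through Lagrangian coinvariants — the consumer).
-/

set_option autoImplicit false

noncomputable section

open scoped TensorProduct

namespace Literature.NumberTheory.Automorphic

/-! ## §1 Generic: functionals on `A ⊗ B` killing first-factor relations -/

section Generic

variable {k : Type*} [CommRing k] {A B C M : Type*} [AddCommGroup A] [Module k A] [AddCommGroup B] [Module k B]
  [AddCommGroup C] [Module k C] [AddCommGroup M] [Module k M]

/-- **A first-factor quotient-scalar passes through a functional killing the first-factor relations.**  If `lam : A ⊗ B → M`
vanishes on `u ⊗ b` for `u ∈ U` and `T a − c • a ∈ U` for every `a` (i.e. `T` preserves nothing in particular but acts on `A ⧸ U`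
by the scalar `c`), then `lam (T a ⊗ b) = c • lam (a ⊗ b)`.  One line: `T a ⊗ b − c • (a ⊗ b) = (T a − c • a) ⊗ b`.
[cite: BourbakiAlgebraI1989, Chap. II §3.6 Prop. 6] -/
theorem apply_tmul_eq_smul_of_sub_smul_mem (lam : A ⊗[k] B →ₗ[k] M) (U : Submodule k A)
    (hU : ∀ u ∈ U, ∀ b : B, lam (u ⊗ₜ b) = 0) (T : A →ₗ[k] A) (c : k) (hT : ∀ a, T a - c • a ∈ U) (a : A) (b : B) :
    lam (T a ⊗ₜ b) = c • lam (a ⊗ₜ b) := by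
  have h0 : lam ((T a - c • a) ⊗ₜ b) = 0 := hU _ (hT a) b
  rw [TensorProduct.sub_tmul, map_sub, ← TensorProduct.smul_tmul', map_smul, sub_eq_zero] at h0
  exact h0

/-- Whole-map form of `apply_tmul_eq_smul_of_sub_smul_mem`: `lam ∘ (T ⊗ 1) = c • lam`.
[cite: BourbakiAlgebraI1989, Chap. II §3.6 Prop. 6] -/
theorem comp_rTensor_eq_smul_of_sub_smul_mem (lam : A ⊗[k] B →ₗ[k] M) (U : Submodule k A)
    (hU : ∀ u ∈ U, ∀ b : B, lam (u ⊗ₜ b) = 0) (T : A →ₗ[k] A) (c : k) (hT : ∀ a, T a - c • a ∈ U) :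
    lam ∘ₗ T.rTensor B = c • lam := by
  refine TensorProduct.ext' fun a b => ?_
  simp only [LinearMap.coe_comp, Function.comp_apply, LinearMap.rTensor_tmul, LinearMap.smul_apply]
  exact apply_tmul_eq_smul_of_sub_smul_mem lam U hU T c hT a b

/-- Transport along a linear equivalence `e : A ⊗ B ≃ C`: for a functional `lam` on `C` killing `e (u ⊗ b)`, `u ∈ U`, and an
operator `T̂` of `C` which is `T ⊗ 1` read through `e` on pure tensors (`T̂ (e (a ⊗ b)) = e (T a ⊗ b)`), with `T` acting on `A ⧸ U`
by the scalar `c`: `lam ∘ T̂ = c • lam`. [cite: BourbakiAlgebraI1989, Chap. II §3.6 Prop. 6] -/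
theorem comp_eq_smul_of_apply_equiv_tmul (e : A ⊗[k] B ≃ₗ[k] C) (lam : C →ₗ[k] M) (U : Submodule k A)
    (hU : ∀ u ∈ U, ∀ b : B, lam (e (u ⊗ₜ b)) = 0) (T : A →ₗ[k] A) (c : k) (hT : ∀ a, T a - c • a ∈ U)
    (That : C →ₗ[k] C) (hThat : ∀ (a : A) (b : B), That (e (a ⊗ₜ b)) = e (T a ⊗ₜ b)) :
    lam ∘ₗ That = c • lam := by
  have hc : (lam ∘ₗ That) ∘ₗ e.toLinearMap = (c • lam) ∘ₗ e.toLinearMap := by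
    refine TensorProduct.ext' fun a b => ?_
    simp only [LinearMap.coe_comp, Function.comp_apply, LinearEquiv.coe_coe, LinearMap.smul_apply, hThat]
    exact apply_tmul_eq_smul_of_sub_smul_mem (lam ∘ₗ e.toLinearMap) U
      (fun u hu b => by simpa only [LinearMap.coe_comp, Function.comp_apply, LinearEquiv.coe_coe] using hU u hu b) T c hT a b
  refine LinearMap.ext fun x => ?_
  have := LinearMap.congr_fun hc (e.symm x)
  simpa only [LinearMap.coe_comp, Function.comp_apply, LinearEquiv.coe_coe, LinearEquiv.apply_symm_apply] using this

/-- Pointwise form of `comp_eq_smul_of_apply_equiv_tmul` on a product: `lam (e (T a ⊗ b)) = c • lam (e (a ⊗ b))`.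
[cite: BourbakiAlgebraI1989, Chap. II §3.6 Prop. 6] -/
theorem apply_equiv_tmul_eq_smul_of_sub_smul_mem (e : A ⊗[k] B ≃ₗ[k] C) (lam : C →ₗ[k] M) (U : Submodule k A)
    (hU : ∀ u ∈ U, ∀ b : B, lam (e (u ⊗ₜ b)) = 0) (T : A →ₗ[k] A) (c : k) (hT : ∀ a, T a - c • a ∈ U) (a : A) (b : B) :
    lam (e (T a ⊗ₜ b)) = c • lam (e (a ⊗ₜ b)) := by
  simpa only [LinearMap.coe_comp, Function.comp_apply, LinearEquiv.coe_coe] using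
    apply_tmul_eq_smul_of_sub_smul_mem (lam ∘ₗ e.toLinearMap) U
      (fun u hu b' => by simpa only [LinearMap.coe_comp, Function.comp_apply, LinearEquiv.coe_coe] using hU u hu b') T c hT a b

/-- **Factorisation through `(A ⧸ U) ⊗ B`** (right exactness of `⊗`, Mathlib `TensorProduct.quotientTensorEquiv`): a linear map
on `A ⊗ B` killing every `u ⊗ b`, `u ∈ U`, descends to `(A ⧸ U) ⊗ B`. [cite: BourbakiAlgebraI1989, Chap. II §3.6 Prop. 6] -/
theorem exists_factor_quotientTensor (lam : A ⊗[k] B →ₗ[k] M) (U : Submodule k A)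
    (hU : ∀ u ∈ U, ∀ b : B, lam (u ⊗ₜ b) = 0) :
    ∃ lamBar : (A ⧸ U) ⊗[k] B →ₗ[k] M, ∀ (a : A) (b : B), lamBar (Submodule.Quotient.mk a ⊗ₜ b) = lam (a ⊗ₜ b) := by
  have hker : LinearMap.range (TensorProduct.map U.subtype (LinearMap.id : B →ₗ[k] B)) ≤ LinearMap.ker lam := by
    rintro _ ⟨t, rfl⟩
    rw [LinearMap.mem_ker]
    induction t using TensorProduct.induction_on with
    | zero => simp only [map_zero]
    | tmul u b => simpa only [TensorProduct.map_tmul, Submodule.coe_subtype, LinearMap.id_coe, id_eq] using hU u u.2 b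
    | add x y hx hy => simp only [map_add, hx, hy, add_zero]
  refine ⟨(LinearMap.range (TensorProduct.map U.subtype (LinearMap.id : B →ₗ[k] B))).liftQ lam hker ∘ₗ
      (TensorProduct.quotientTensorEquiv B U).toLinearMap, fun a b => ?_⟩
  simp only [LinearMap.coe_comp, Function.comp_apply, LinearEquiv.coe_coe, TensorProduct.quotientTensorEquiv_apply_tmul_mk,
    Submodule.liftQ_apply]

end Generic

section Field

variable {k : Type*} [Field k] {C : Type*} [AddCommGroup C] [Module k C]

/-- **Uniqueness of the scalar** (the «pick a vector where `lam ≠ 0`» step): if `lam ∘ T̂ = c • lam` and `lam ∘ T̂ = c' • lam` for a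
non-zero functional `lam`, then `c' = c`. [cite: BourbakiAlgebraI1989, Chap. II §3.6 Prop. 6] -/
theorem eq_of_comp_eq_smul_of_ne_zero (lam : C →ₗ[k] k) (That : C →ₗ[k] C) (c c' : k)
    (hc : lam ∘ₗ That = c • lam) (hc' : lam ∘ₗ That = c' • lam) (hlam : lam ≠ 0) : c' = c := by
  obtain ⟨x, hx⟩ : ∃ x, lam x ≠ 0 := by
    by_contra h
    push Not at h
    exact hlam (LinearMap.ext h)
  have h1 := LinearMap.congr_fun hc x
  have h2 := LinearMap.congr_fun hc' x
  rw [h1, LinearMap.smul_apply, LinearMap.smul_apply, smul_eq_mul, smul_eq_mul] at h2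
  exact (mul_right_cancel₀ hx h2).symm

/-- Pointwise uniqueness: if `lam (T̂ x) = c • lam x` and `lam (T̂ x) = c' • lam x` at ONE `x` with `lam x ≠ 0`, then `c' = c`.
[cite: BourbakiAlgebraI1989, Chap. II §3.6 Prop. 6] -/
theorem eq_of_apply_eq_smul_of_apply_ne_zero (lam : C →ₗ[k] k) (x y : C) (c c' : k)
    (hc : lam y = c * lam x) (hc' : lam y = c' * lam x) (hx : lam x ≠ 0) : c' = c :=
  (mul_right_cancel₀ hx (hc'.symm.trans hc))

end Field

/-! ## §2 The Schwartz–Bruhat instance: `lam ((B₁ f₁) ⊠ f₂) = c · lam (f₁ ⊠ f₂)` -/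

section LocalField

open Literature.NumberTheory.GaloisRepresentations.IsNonarchimedeanLocalField

variable (K : Type*) [Field K] [ValuativeRel K] [TopologicalSpace K] [IsNonarchimedeanLocalField K]
  {ι₁ ι₂ ι : Type*} (e : ι₁ ⊕ ι₂ ≃ ι) [Fintype ι₁] [Fintype ι₂] [Fintype ι]
  {M : Type*} [AddCommGroup M] [Module ℂ M]

/-- **(D3c) at a finite place.**  Let `lam` be a linear map on `𝒮(K^ι)` vanishing on all products `u ⊠ f₂` with `u` in a submodule
`U ≤ 𝒮(K^{ι₁})` of first-factor relations, and let `B₁` act on `𝒮(K^{ι₁}) ⧸ U` by the scalar `c` (`B₁ f₁ − c • f₁ ∈ U`).  Then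
`lam ((B₁ f₁) ⊠ f₂) = c • lam (f₁ ⊠ f₂)`. [cite: WeilBNT1967, Chap. VII §2, Prop. 2] [cite: BourbakiAlgebraI1989, Chap. II §3.6 Prop. 6] -/
theorem apply_boxSB_eq_smul_of_sub_smul_mem (lam : SchwartzBruhat (ι → K) →ₗ[ℂ] M) (U : Submodule ℂ (SchwartzBruhat (ι₁ → K)))
    (hU : ∀ u ∈ U, ∀ f₂ : SchwartzBruhat (ι₂ → K), lam (boxSB K e u f₂) = 0)
    (B₁ : SchwartzBruhat (ι₁ → K) →ₗ[ℂ] SchwartzBruhat (ι₁ → K)) (c : ℂ) (hB : ∀ f₁, B₁ f₁ - c • f₁ ∈ U)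
    (f₁ : SchwartzBruhat (ι₁ → K)) (f₂ : SchwartzBruhat (ι₂ → K)) :
    lam (boxSB K e (B₁ f₁) f₂) = c • lam (boxSB K e f₁ f₂) :=
  apply_equiv_tmul_eq_smul_of_sub_smul_mem (sumEquivSB K e) lam U hU B₁ c hB f₁ f₂

/-- Scalar-valued form of `apply_boxSB_eq_smul_of_sub_smul_mem`: `lam ((B₁ f₁) ⊠ f₂) = c * lam (f₁ ⊠ f₂)`.
[cite: WeilBNT1967, Chap. VII §2, Prop. 2] [cite: BourbakiAlgebraI1989, Chap. II §3.6 Prop. 6] -/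
theorem apply_boxSB_eq_mul_of_sub_smul_mem (lam : SchwartzBruhat (ι → K) →ₗ[ℂ] ℂ) (U : Submodule ℂ (SchwartzBruhat (ι₁ → K)))
    (hU : ∀ u ∈ U, ∀ f₂ : SchwartzBruhat (ι₂ → K), lam (boxSB K e u f₂) = 0)
    (B₁ : SchwartzBruhat (ι₁ → K) →ₗ[ℂ] SchwartzBruhat (ι₁ → K)) (c : ℂ) (hB : ∀ f₁, B₁ f₁ - c • f₁ ∈ U)
    (f₁ : SchwartzBruhat (ι₁ → K)) (f₂ : SchwartzBruhat (ι₂ → K)) :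
    lam (boxSB K e (B₁ f₁) f₂) = c * lam (boxSB K e f₁ f₂) :=
  apply_boxSB_eq_smul_of_sub_smul_mem K e lam U hU B₁ c hB f₁ f₂

/-- **Whole-map form: `lam ∘ (B₁ ⊠ 1) = c • lam`** on all of `𝒮(K^ι)` (★ `sumEndSB K e B₁ 1 = B₁ ⊠ 1`, extensionality on products
★ `linearMap_ext_boxSB`). [cite: MoeglinVignerasWaldspurger1987, Chap. 2 II.1 Rem. (6)] [cite: BourbakiAlgebraI1989, Chap. II §3.6 Prop. 6] -/
theorem comp_sumEndSB_id_eq_smul_of_sub_smul_mem (lam : SchwartzBruhat (ι → K) →ₗ[ℂ] M)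
    (U : Submodule ℂ (SchwartzBruhat (ι₁ → K)))
    (hU : ∀ u ∈ U, ∀ f₂ : SchwartzBruhat (ι₂ → K), lam (boxSB K e u f₂) = 0)
    (B₁ : SchwartzBruhat (ι₁ → K) →ₗ[ℂ] SchwartzBruhat (ι₁ → K)) (c : ℂ) (hB : ∀ f₁, B₁ f₁ - c • f₁ ∈ U) :
    lam ∘ₗ sumEndSB K e B₁ LinearMap.id = c • lam :=
  comp_eq_smul_of_apply_equiv_tmul (sumEquivSB K e) lam U hU B₁ c hB (sumEndSB K e B₁ LinearMap.id) fun f₁ f₂ => by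
    rw [sumEquivSB_tmul, sumEquivSB_tmul, sumEndSB_boxSB, LinearMap.id_coe, id_eq]

/-- Applied form: `lam ((B₁ ⊠ 1) Φ) = c • lam Φ` for EVERY `Φ ∈ 𝒮(K^ι)` (not only products).
[cite: MoeglinVignerasWaldspurger1987, Chap. 2 II.1 Rem. (6)] [cite: BourbakiAlgebraI1989, Chap. II §3.6 Prop. 6] -/
theorem apply_sumEndSB_id_eq_smul_of_sub_smul_mem (lam : SchwartzBruhat (ι → K) →ₗ[ℂ] M)
    (U : Submodule ℂ (SchwartzBruhat (ι₁ → K)))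
    (hU : ∀ u ∈ U, ∀ f₂ : SchwartzBruhat (ι₂ → K), lam (boxSB K e u f₂) = 0)
    (B₁ : SchwartzBruhat (ι₁ → K) →ₗ[ℂ] SchwartzBruhat (ι₁ → K)) (c : ℂ) (hB : ∀ f₁, B₁ f₁ - c • f₁ ∈ U)
    (Φ : SchwartzBruhat (ι → K)) :
    lam (sumEndSB K e B₁ LinearMap.id Φ) = c • lam Φ := by
  have := LinearMap.congr_fun (comp_sumEndSB_id_eq_smul_of_sub_smul_mem K e lam U hU B₁ c hB) Φ
  simpa only [LinearMap.coe_comp, Function.comp_apply, LinearMap.smul_apply] using this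

/-- **(D3d) uniqueness at a finite place**: if `lam ∘ (B₁ ⊠ 1) = c' • lam` (an eigen-law obtained elsewhere), `lam ≠ 0`, `lam` kills
the first-factor relations `U`, and `B₁` acts on `𝒮(K^{ι₁}) ⧸ U` by `c`, then `c' = c`.
[cite: MoeglinVignerasWaldspurger1987, Chap. 2 II.1 Rem. (6)] [cite: BourbakiAlgebraI1989, Chap. II §3.6 Prop. 6] -/
theorem eq_of_comp_sumEndSB_id_eq_smul (lam : SchwartzBruhat (ι → K) →ₗ[ℂ] ℂ) (U : Submodule ℂ (SchwartzBruhat (ι₁ → K)))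
    (hU : ∀ u ∈ U, ∀ f₂ : SchwartzBruhat (ι₂ → K), lam (boxSB K e u f₂) = 0)
    (B₁ : SchwartzBruhat (ι₁ → K) →ₗ[ℂ] SchwartzBruhat (ι₁ → K)) (c c' : ℂ) (hB : ∀ f₁, B₁ f₁ - c • f₁ ∈ U)
    (hc' : lam ∘ₗ sumEndSB K e B₁ LinearMap.id = c' • lam) (hlam : lam ≠ 0) : c' = c :=
  eq_of_comp_eq_smul_of_ne_zero lam (sumEndSB K e B₁ LinearMap.id) c c'
    (comp_sumEndSB_id_eq_smul_of_sub_smul_mem K e lam U hU B₁ c hB) hc' hlam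

/-- **(D3d) uniqueness read at ONE product**: if `lam ((B₁ f₁) ⊠ f₂) = c' * lam (f₁ ⊠ f₂)` for some product with `lam (f₁ ⊠ f₂) ≠ 0`,
`lam` kills the first-factor relations `U`, and `B₁` acts on `𝒮(K^{ι₁}) ⧸ U` by `c`, then `c' = c`.
[cite: WeilBNT1967, Chap. VII §2, Prop. 2] [cite: BourbakiAlgebraI1989, Chap. II §3.6 Prop. 6] -/
theorem eq_of_apply_boxSB_eq_mul_of_ne_zero (lam : SchwartzBruhat (ι → K) →ₗ[ℂ] ℂ) (U : Submodule ℂ (SchwartzBruhat (ι₁ → K)))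
    (hU : ∀ u ∈ U, ∀ f₂ : SchwartzBruhat (ι₂ → K), lam (boxSB K e u f₂) = 0)
    (B₁ : SchwartzBruhat (ι₁ → K) →ₗ[ℂ] SchwartzBruhat (ι₁ → K)) (c c' : ℂ) (hB : ∀ f₁, B₁ f₁ - c • f₁ ∈ U)
    (f₁ : SchwartzBruhat (ι₁ → K)) (f₂ : SchwartzBruhat (ι₂ → K))
    (hc' : lam (boxSB K e (B₁ f₁) f₂) = c' * lam (boxSB K e f₁ f₂)) (hne : lam (boxSB K e f₁ f₂) ≠ 0) : c' = c :=
  eq_of_apply_eq_smul_of_apply_ne_zero lam (boxSB K e f₁ f₂) (boxSB K e (B₁ f₁) f₂) c c'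
    (apply_boxSB_eq_mul_of_sub_smul_mem K e lam U hU B₁ c hB f₁ f₂) hc' hne

/-- A non-zero functional on `𝒮(K^ι)` is non-zero on SOME product `f₁ ⊠ f₂` (products span, ★ `linearMap_ext_boxSB`) — the
existence half of the «pick `f₁ ⊠ f₂` with `λ′(f₁ ⊠ f₂) ≠ 0`» step. [cite: WeilBNT1967, Chap. VII §2, Prop. 2] -/
theorem exists_apply_boxSB_ne_zero (lam : SchwartzBruhat (ι → K) →ₗ[ℂ] M) (hlam : lam ≠ 0) :
    ∃ (f₁ : SchwartzBruhat (ι₁ → K)) (f₂ : SchwartzBruhat (ι₂ → K)), lam (boxSB K e f₁ f₂) ≠ 0 := by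
  by_contra h
  push Not at h
  exact hlam (linearMap_ext_boxSB K e (B := 0) fun f₁ f₂ => by rw [h f₁ f₂, LinearMap.zero_apply])

end LocalField

end Literature.NumberTheory.Automorphic

end
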